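import Summits.BirchSwinnertonDyer.BirchSwinnertonDyer.Theses.ShadowIsolation
import Summits.BirchSwinnertonDyer.BirchSwinnertonDyer.Theses.NormCapitulation

/-!
# BirchSwinnertonDyer / NormCapitulation (+ ShadowIsolation) — crux `ShaCotorsionReducible`
# (stmt-BirchSwinnertonDyer-15277): composition certificate of the strategist line
# `Cruxes/ShaCotorsionReducible/Lines/eisenstein_norm_capitulation.lean`

Crux-strategist s1. The five sub-statements of the line `eisenstein-norm-capitulation` — the route's own
junction (universal norms → Herbrand count of the cyclic layers; phantom capitulation; squeeze)
transferred to the Eisenstein prime `p` itself, at a Heegner field `K` in which `p` SPLITS and with `d_K`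
odd (where Λ-rank one of the anticyclotomic Selmer group is a theorem with NO image hypothesis:
Keller–Yin, arXiv:2402.12781 Thm 2; Castella–Grossi–Lee–Skinner, arXiv:2008.02571 = Invent. Math. 227
(2022), Thm 39/41) — imply the crux. The sub-statements appear here as INLINE hypotheses (they are the
registered-ready stubs `stub_universalNormReducible`, `stub_phantomCapitulationReducible`,
`stub_towerRankGrowthReducible`, `stub_herbrandCount`, `stub_capitulationSqueezeAnyImage` of the line
file, verbatim), so this file declares nothing new and proves, sorry-free with standard axioms:

* `shaCotorsionReducible_of_eisensteinNormCapitulation_subs` — UN_red → CAP_red → TRG_red → HC → SQ →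
  `NormCapitulation.ShaCotorsionReducible`: take `K`, `κ` and the universal-norm datum from UN_red; HC turns
  the tower rank bound TRG_red and the datum into a bounded capitulation exponent; SQ combines it with
  CAP_red into `shaCorank p = 0`;
* `shadowIsolation_shaCotorsionReducible_of_eisensteinNormCapitulation_subs` — the same for the rfl-equal
  decl of route `ShadowIsolation` (the registered crux decl of the item).

UN_red / CAP_red are Mazur's universal-norm conjecture and the phantom-capitulation conjecture restricted
to the sector (the route's own bets #2/#3, no harder there); TRG_red is `rank E(K_n) ≤ pⁿ + C₁` (in print);
HC is image-free, sector-free algebra of `H¹` of cyclic layers (paper proof in the line card); SQ is the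
route's `CapitulationSqueeze` with the unused irreducibility hypothesis deleted.
-/

-- D-0017: single-problem summit, so `Summit.BirchSwinnertonDyer.BirchSwinnertonDyer.…` repeats a
-- namespace BY DESIGN.
set_option linter.dupNamespace false

namespace Summit.BirchSwinnertonDyer.BirchSwinnertonDyer.Theorems

open scoped BigOperators
open Summit.BirchSwinnertonDyer.BirchSwinnertonDyer.Theses

/-- **Line `eisenstein-norm-capitulation` decides the crux.** UN_red (a Heegner field `K` with
`p` split and `d_K` odd, an anticyclotomic `ℤ_p`-extension `κ` and the `p`-adic universal-norm datum) →
CAP_red (phantom capitulation at every such `K`, `κ`) → TRG_red (`rank E(K_n) ≤ pⁿ + C₁`) → HC (Herbrand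
count: rank bound + datum ⇒ bounded capitulation exponent) → SQ (capitulation squeeze, any image) ⇒
`shaCorank p = 0` at every good ordinary Eisenstein `p ≥ 5`. [cite: Bertolini1995, Introduction]
[cite: Greenberg1999LNM, §1 pp. 54–57] -/
theorem shaCotorsionReducible_of_eisensteinNormCapitulation_subs
    (hUN : ∀ (V : WeierstrassCurve ℚ) [V.IsElliptic] [V.IsGloballyMinimal] (p : ℕ) [Fact p.Prime], 5 ≤ p → V.HasGoodReductionAtPrime p → ¬ (p : ℤ) ∣ V.frobeniusTrace p → ¬ V.HasIrreducibleModPGaloisRep p → ∃ (K : Type) (_ : Field K) (_ : NumberField K), (Module.finrank ℚ K = 2 ∧ NumberField.IsTotallyComplex K ∧ NumberField.discr K < -4 ∧ Int.gcd (NumberField.discr K) (V.conductorNorm ℤ * p) = 1 ∧ (∀ q : ℕ, q.Prime → q ∣ V.conductorNorm ℤ → ((Ideal.span {(q : ℤ)}).primesOver (NumberField.RingOfIntegers K)).ncard = 2) ∧ ((Ideal.span {(p : ℤ)}).primesOver (NumberField.RingOfIntegers K)).ncard = 2 ∧ Odd (NumberField.discr K)) ∧ ∃ κ : Literature.NumberTheory.EllipticCurves.ZpExtension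 K p, κ.IsAnticyclotomic ∧ ∃ c : ℕ, ∀ n : ℕ, ∃ P : (V.baseChange K).geomPoints, (∀ τ ∈ κ.layerSubgroup n, τ • P = P) ∧ ∃ σ : ZMod (p ^ n) → Field.absoluteGaloisGroup K, (∀ a : ZMod (p ^ n), PadicInt.toZModPow n (Multiplicative.toAdd (κ (σ a))) = a) ∧ ∀ Q : (V.baseChange K).geomPoints, (∀ g : Field.absoluteGaloisGroup K, g • Q = Q) → ∀ m : ℕ, 0 < m → m • ((∑ a : ZMod (p ^ n), σ a • P) - p ^ c • Q) ≠ 0)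
    (hCap : ∀ (V : WeierstrassCurve ℚ) [V.IsElliptic] [V.IsGloballyMinimal] (p : ℕ) [Fact p.Prime], 5 ≤ p → V.HasGoodReductionAtPrime p → ¬ (p : ℤ) ∣ V.frobeniusTrace p → ¬ V.HasIrreducibleModPGaloisRep p → ∀ (K : Type) [Field K] [NumberField K], (Module.finrank ℚ K = 2 ∧ NumberField.IsTotallyComplex K ∧ NumberField.discr K < -4 ∧ Int.gcd (NumberField.discr K) (V.conductorNorm ℤ * p) = 1 ∧ (∀ q : ℕ, q.Prime → q ∣ V.conductorNorm ℤ → ((Ideal.span {(q : ℤ)}).primesOver (NumberField.RingOfIntegers K)).ncard = 2) ∧ ((Ideal.span {(p : ℤ)}).primesOver (NumberField.RingOfIntegers K)).ncard = 2 ∧ Odd (NumberField.discr K)) → ∀ κ : Literature.NumberTheory.EllipticCurves.ZpExtension K p, κ.IsAnticyclotomic → ∀ ξ : ↥(V.baseChange K).sha, (∃ k : ℕ, p ^ k • ξ = 0) → (∀ k : ℕ, ∃ η : ↥(V.baseChange K).sha, p ^ k • η = ξ) → ∃ (n : ℕ) (_ : NumberField ↥(κ.layer n)), Literature.NumberTheory.EllipticCurves.shaRestriction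 (V.baseChange K) ↥(κ.layer n) ξ = 0)
    (hTRG : ∀ (V : WeierstrassCurve ℚ) [V.IsElliptic] [V.IsGloballyMinimal] (p : ℕ) [Fact p.Prime], 5 ≤ p → V.HasGoodReductionAtPrime p → ¬ (p : ℤ) ∣ V.frobeniusTrace p → ¬ V.HasIrreducibleModPGaloisRep p → ∀ (K : Type) [Field K] [NumberField K], (Module.finrank ℚ K = 2 ∧ NumberField.IsTotallyComplex K ∧ NumberField.discr K < -4 ∧ Int.gcd (NumberField.discr K) (V.conductorNorm ℤ * p) = 1 ∧ (∀ q : ℕ, q.Prime → q ∣ V.conductorNorm ℤ → ((Ideal.span {(q : ℤ)}).primesOver (NumberField.RingOfIntegers K)).ncard = 2) ∧ ((Ideal.span {(p : ℤ)}).primesOver (NumberField.RingOfIntegers K)).ncard = 2 ∧ Odd (NumberField.discr K)) → ∀ κ : Literature.NumberTheory.EllipticCurves.ZpExtension K p, κ.IsAnticyclotomic → ∃ C₁ : ℕ, ∀ (n : ℕ) (s : Finset (V.baseChange K).geomPoints), (∀ P ∈ s, ∀ τ ∈ κ.layerSubgroup n, τ • P = P) → LinearIndependent ℤ (fun P : ↥s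 => (P : (V.baseChange K).geomPoints)) → s.card ≤ p ^ n + C₁)
    (hHC : ∀ (V : WeierstrassCurve ℚ) [V.IsElliptic] [V.IsGloballyMinimal] (p : ℕ) [Fact p.Prime], 5 ≤ p → V.HasGoodReductionAtPrime p → ¬ (p : ℤ) ∣ V.frobeniusTrace p → ∀ (K : Type) [Field K] [NumberField K], (Module.finrank ℚ K = 2 ∧ NumberField.IsTotallyComplex K ∧ NumberField.discr K < -4 ∧ Int.gcd (NumberField.discr K) (V.conductorNorm ℤ * p) = 1 ∧ (∀ q : ℕ, q.Prime → q ∣ V.conductorNorm ℤ → ((Ideal.span {(q : ℤ)}).primesOver (NumberField.RingOfIntegers K)).ncard = 2) ∧ ((Ideal.span {(p : ℤ)}).primesOver (NumberField.RingOfIntegers K)).ncard = 2 ∧ Odd (NumberField.discr K)) → ∀ κ : Literature.NumberTheory.EllipticCurves.ZpExtension K p, κ.IsAnticyclotomic → (∃ C₁ : ℕ, ∀ (n : ℕ) (s : Finset (V.baseChange K).geomPoints), (∀ P ∈ s, ∀ τ ∈ κ.layerSubgroup n, τ • P = P) → LinearIndependent ℤ (fun P : ↥s => (P : (V.baseChange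 K).geomPoints)) → s.card ≤ p ^ n + C₁) → (∃ c : ℕ, ∀ n : ℕ, ∃ P : (V.baseChange K).geomPoints, (∀ τ ∈ κ.layerSubgroup n, τ • P = P) ∧ ∃ σ : ZMod (p ^ n) → Field.absoluteGaloisGroup K, (∀ a : ZMod (p ^ n), PadicInt.toZModPow n (Multiplicative.toAdd (κ (σ a))) = a) ∧ ∀ Q : (V.baseChange K).geomPoints, (∀ g : Field.absoluteGaloisGroup K, g • Q = Q) → ∀ m : ℕ, 0 < m → m • ((∑ a : ZMod (p ^ n), σ a • P) - p ^ c • Q) ≠ 0) → ∃ C : ℕ, ∀ (n : ℕ) (_ : NumberField ↥(κ.layer n)) (ξ : ↥(V.baseChange K).sha), (∃ k : ℕ, p ^ k • ξ = 0) → Literature.NumberTheory.EllipticCurves.shaRestriction (V.baseChange K) ↥(κ.layer n) ξ = 0 → p ^ C • ξ = 0)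
    (hSq : ∀ (V : WeierstrassCurve ℚ) [V.IsElliptic] [V.IsGloballyMinimal] (p : ℕ) [Fact p.Prime], 5 ≤ p → V.HasGoodReductionAtPrime p → ¬ (p : ℤ) ∣ V.frobeniusTrace p → ∀ (K : Type) [Field K] [NumberField K], (Module.finrank ℚ K = 2 ∧ NumberField.IsTotallyComplex K ∧ NumberField.discr K < -4 ∧ Int.gcd (NumberField.discr K) (V.conductorNorm ℤ * p) = 1 ∧ (∀ q : ℕ, q.Prime → q ∣ V.conductorNorm ℤ → ((Ideal.span {(q : ℤ)}).primesOver (NumberField.RingOfIntegers K)).ncard = 2) ∧ ((Ideal.span {(p : ℤ)}).primesOver (NumberField.RingOfIntegers K)).ncard = 2 ∧ Odd (NumberField.discr K)) → ∀ κ : Literature.NumberTheory.EllipticCurves.ZpExtension K p, κ.IsAnticyclotomic → (∀ ξ : ↥(V.baseChange K).sha, (∃ k : ℕ, p ^ k • ξ = 0) → (∀ k : ℕ, ∃ η : ↥(V.baseChange K).sha, p ^ k • η = ξ) → ∃ (n : ℕ) (_ : NumberField ↥(κ.layer n)), Literature.NumberTheory.EllipticCurves.shaRestriction (V.baseChange K)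 ↥(κ.layer n) ξ = 0) → (∃ C : ℕ, ∀ (n : ℕ) (_ : NumberField ↥(κ.layer n)) (ξ : ↥(V.baseChange K).sha), (∃ k : ℕ, p ^ k • ξ = 0) → Literature.NumberTheory.EllipticCurves.shaRestriction (V.baseChange K) ↥(κ.layer n) ξ = 0 → p ^ C • ξ = 0) → V.shaCorank p = 0) :
    NormCapitulation.ShaCotorsionReducible := by
  intro W _ _ p _ h5 hgood hord hred
  obtain ⟨K, iK, iNK, hK, κ, hκ, hdatum⟩ := hUN W p h5 hgood hord hred
  exact hSq W p h5 hgood hord K hK κ hκ (hCap W p h5 hgood hord hred K hK κ hκ)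
    (hHC W p h5 hgood hord K hK κ hκ (hTRG W p h5 hgood hord hred K hK κ hκ) hdatum)

/-- **The same for the registered crux decl of route `ShadowIsolation`** (rfl-equal statement).
[cite: Bertolini1995, Introduction] [cite: Greenberg1999LNM, §1 pp. 54–57] -/
theorem shadowIsolation_shaCotorsionReducible_of_eisensteinNormCapitulation_subs
    (hUN : ∀ (V : WeierstrassCurve ℚ) [V.IsElliptic] [V.IsGloballyMinimal] (p : ℕ) [Fact p.Prime], 5 ≤ p → V.HasGoodReductionAtPrime p → ¬ (p : ℤ) ∣ V.frobeniusTrace p → ¬ V.HasIrreducibleModPGaloisRep p → ∃ (K : Type) (_ : Field K) (_ : NumberField K), (Module.finrank ℚ K = 2 ∧ NumberField.IsTotallyComplex K ∧ NumberField.discr K < -4 ∧ Int.gcd (NumberField.discr K) (V.conductorNorm ℤ * p) = 1 ∧ (∀ q : ℕ, q.Prime → q ∣ V.conductorNorm ℤ → ((Ideal.span {(q : ℤ)}).primesOver (NumberField.RingOfIntegers K)).ncard = 2) ∧ ((Ideal.span {(p : ℤ)}).primesOver (NumberField.RingOfIntegers K)).ncard = 2 ∧ Odd (NumberField.discr K))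 ∧ ∃ κ : Literature.NumberTheory.EllipticCurves.ZpExtension K p, κ.IsAnticyclotomic ∧ ∃ c : ℕ, ∀ n : ℕ, ∃ P : (V.baseChange K).geomPoints, (∀ τ ∈ κ.layerSubgroup n, τ • P = P) ∧ ∃ σ : ZMod (p ^ n) → Field.absoluteGaloisGroup K, (∀ a : ZMod (p ^ n), PadicInt.toZModPow n (Multiplicative.toAdd (κ (σ a))) = a) ∧ ∀ Q : (V.baseChange K).geomPoints, (∀ g : Field.absoluteGaloisGroup K, g • Q = Q) → ∀ m : ℕ, 0 < m → m • ((∑ a : ZMod (p ^ n), σ a • P) - p ^ c • Q) ≠ 0)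
    (hCap : ∀ (V : WeierstrassCurve ℚ) [V.IsElliptic] [V.IsGloballyMinimal] (p : ℕ) [Fact p.Prime], 5 ≤ p → V.HasGoodReductionAtPrime p → ¬ (p : ℤ) ∣ V.frobeniusTrace p → ¬ V.HasIrreducibleModPGaloisRep p → ∀ (K : Type) [Field K] [NumberField K], (Module.finrank ℚ K = 2 ∧ NumberField.IsTotallyComplex K ∧ NumberField.discr K < -4 ∧ Int.gcd (NumberField.discr K) (V.conductorNorm ℤ * p) = 1 ∧ (∀ q : ℕ, q.Prime → q ∣ V.conductorNorm ℤ → ((Ideal.span {(q : ℤ)}).primesOver (NumberField.RingOfIntegers K)).ncard = 2) ∧ ((Ideal.span {(p : ℤ)}).primesOver (NumberField.RingOfIntegers K)).ncard = 2 ∧ Odd (NumberField.discr K)) → ∀ κ : Literature.NumberTheory.EllipticCurves.ZpExtension K p, κ.IsAnticyclotomic → ∀ ξ : ↥(V.baseChange K).sha, (∃ k : ℕ, p ^ k • ξ = 0) → (∀ k : ℕ, ∃ η : ↥(V.baseChange K).sha, p ^ k • η = ξ) → ∃ (n : ℕ) (_ : NumberField ↥(κ.layer n)), Literature.NumberTheory.EllipticCurves.shaRestriction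 (V.baseChange K) ↥(κ.layer n) ξ = 0)
    (hTRG : ∀ (V : WeierstrassCurve ℚ) [V.IsElliptic] [V.IsGloballyMinimal] (p : ℕ) [Fact p.Prime], 5 ≤ p → V.HasGoodReductionAtPrime p → ¬ (p : ℤ) ∣ V.frobeniusTrace p → ¬ V.HasIrreducibleModPGaloisRep p → ∀ (K : Type) [Field K] [NumberField K], (Module.finrank ℚ K = 2 ∧ NumberField.IsTotallyComplex K ∧ NumberField.discr K < -4 ∧ Int.gcd (NumberField.discr K) (V.conductorNorm ℤ * p) = 1 ∧ (∀ q : ℕ, q.Prime → q ∣ V.conductorNorm ℤ → ((Ideal.span {(q : ℤ)}).primesOver (NumberField.RingOfIntegers K)).ncard = 2) ∧ ((Ideal.span {(p : ℤ)}).primesOver (NumberField.RingOfIntegers K)).ncard = 2 ∧ Odd (NumberField.discr K)) → ∀ κ : Literature.NumberTheory.EllipticCurves.ZpExtension K p, κ.IsAnticyclotomic → ∃ C₁ : ℕ, ∀ (n : ℕ) (s : Finset (V.baseChange K).geomPoints), (∀ P ∈ s, ∀ τ ∈ κ.layerSubgroup n, τ • P = P) → LinearIndependent ℤ (fun P : ↥s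 => (P : (V.baseChange K).geomPoints)) → s.card ≤ p ^ n + C₁)
    (hHC : ∀ (V : WeierstrassCurve ℚ) [V.IsElliptic] [V.IsGloballyMinimal] (p : ℕ) [Fact p.Prime], 5 ≤ p → V.HasGoodReductionAtPrime p → ¬ (p : ℤ) ∣ V.frobeniusTrace p → ∀ (K : Type) [Field K] [NumberField K], (Module.finrank ℚ K = 2 ∧ NumberField.IsTotallyComplex K ∧ NumberField.discr K < -4 ∧ Int.gcd (NumberField.discr K) (V.conductorNorm ℤ * p) = 1 ∧ (∀ q : ℕ, q.Prime → q ∣ V.conductorNorm ℤ → ((Ideal.span {(q : ℤ)}).primesOver (NumberField.RingOfIntegers K)).ncard = 2) ∧ ((Ideal.span {(p : ℤ)}).primesOver (NumberField.RingOfIntegers K)).ncard = 2 ∧ Odd (NumberField.discr K)) → ∀ κ : Literature.NumberTheory.EllipticCurves.ZpExtension K p, κ.IsAnticyclotomic → (∃ C₁ : ℕ, ∀ (n : ℕ) (s : Finset (V.baseChange K).geomPoints), (∀ P ∈ s, ∀ τ ∈ κ.layerSubgroup n, τ • P = P) → LinearIndependent ℤ (fun P : ↥s => (P : (V.baseChange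 K).geomPoints)) → s.card ≤ p ^ n + C₁) → (∃ c : ℕ, ∀ n : ℕ, ∃ P : (V.baseChange K).geomPoints, (∀ τ ∈ κ.layerSubgroup n, τ • P = P) ∧ ∃ σ : ZMod (p ^ n) → Field.absoluteGaloisGroup K, (∀ a : ZMod (p ^ n), PadicInt.toZModPow n (Multiplicative.toAdd (κ (σ a))) = a) ∧ ∀ Q : (V.baseChange K).geomPoints, (∀ g : Field.absoluteGaloisGroup K, g • Q = Q) → ∀ m : ℕ, 0 < m → m • ((∑ a : ZMod (p ^ n), σ a • P) - p ^ c • Q) ≠ 0) → ∃ C : ℕ, ∀ (n : ℕ) (_ : NumberField ↥(κ.layer n)) (ξ : ↥(V.baseChange K).sha), (∃ k : ℕ, p ^ k • ξ = 0) → Literature.NumberTheory.EllipticCurves.shaRestriction (V.baseChange K) ↥(κ.layer n) ξ = 0 → p ^ C • ξ = 0)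
    (hSq : ∀ (V : WeierstrassCurve ℚ) [V.IsElliptic] [V.IsGloballyMinimal] (p : ℕ) [Fact p.Prime], 5 ≤ p → V.HasGoodReductionAtPrime p → ¬ (p : ℤ) ∣ V.frobeniusTrace p → ∀ (K : Type) [Field K] [NumberField K], (Module.finrank ℚ K = 2 ∧ NumberField.IsTotallyComplex K ∧ NumberField.discr K < -4 ∧ Int.gcd (NumberField.discr K) (V.conductorNorm ℤ * p) = 1 ∧ (∀ q : ℕ, q.Prime → q ∣ V.conductorNorm ℤ → ((Ideal.span {(q : ℤ)}).primesOver (NumberField.RingOfIntegers K)).ncard = 2) ∧ ((Ideal.span {(p : ℤ)}).primesOver (NumberField.RingOfIntegers K)).ncard = 2 ∧ Odd (NumberField.discr K)) → ∀ κ : Literature.NumberTheory.EllipticCurves.ZpExtension K p, κ.IsAnticyclotomic → (∀ ξ : ↥(V.baseChange K).sha, (∃ k : ℕ, p ^ k • ξ = 0) → (∀ k : ℕ, ∃ η : ↥(V.baseChange K).sha, p ^ k • η = ξ) → ∃ (n : ℕ) (_ : NumberField ↥(κ.layer n)), Literature.NumberTheory.EllipticCurves.shaRestriction (V.baseChange K)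 ↥(κ.layer n) ξ = 0) → (∃ C : ℕ, ∀ (n : ℕ) (_ : NumberField ↥(κ.layer n)) (ξ : ↥(V.baseChange K).sha), (∃ k : ℕ, p ^ k • ξ = 0) → Literature.NumberTheory.EllipticCurves.shaRestriction (V.baseChange K) ↥(κ.layer n) ξ = 0 → p ^ C • ξ = 0) → V.shaCorank p = 0) :
    ShadowIsolation.ShaCotorsionReducible :=
  shaCotorsionReducible_of_eisensteinNormCapitulation_subs hUN hCap hTRG hHC hSq

end Summit.BirchSwinnertonDyer.BirchSwinnertonDyer.Theorems
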